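/-
Copyright (c) 2026 the pub-hodgecm-mathlib formalisation cell (harness21).  Prover seat hodgecm-mathlib-LH4-p07 (g11) (Track A «FOUR-FRAME» free hand routed by the
CHAIR VALVE to L1; LEAD F0P6-plan (g14) BATCH #173 (1) «the K1 twisted per-place producer» → LH4-p07), Track B «K2-LIT», #184♮ = hLiu418 = stmt-HodgeConjecture-24832;
desk K2E5-p16 (g8), second reader K2E3-p37 (g2).  THE K1 TWISTED LOCAL FACE — the twin of ★ (E10) `K2LiuBigCellLocalFace.exists_localFace` for the CORNER-TWISTED
big-cell integral, in ★ G1's `unipDeltaLoc ∕ locToAdelic` currency: ★ p862868 (non-split) ∕ ★ p862834 (split) over ★ `placesOver_cases'`, the Levi shift of ★ B4d-3, the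
corner-character reading ★ `K2LiuRankOneCornerCharacterReading` (the seam (σ)), and ★ B1's subgroup transport.
-/
import Summits.HodgeConjecture.HodgeConjecture.Theorems.K2LiuRankOneSingularLocalRegularity        -- ★ p862868 (K2E3-p29): `twistedRankOneRegularity_of_forall_eq` (+ ★ B4d-3, ★ B2, ★ A7 letters)
import Summits.HodgeConjecture.HodgeConjecture.Theorems.K2LiuRankOneSingularLocalRegularitySplit   -- ★ p862834 (LH4-p10): `twistedRegularity_of_pair`
import Summits.HodgeConjecture.HodgeConjecture.Theorems.K2LiuRankOneCornerCharacterReading         -- ★ (K2E5-p16): `exists_adaptedFrame_eq`, `conj_unipDeltaChar_single_locToAdelic_frameConj_nSiegel`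
import Summits.HodgeConjecture.HodgeConjecture.Theorems.K2LiuUnipDeltaLocIntegralTransport         -- ★ (K2Liu-p13 lineage): ★ B1 `unipDeltaLoc_eq_unipDeltaLocal`, ★ `evalPlace_finPart_weylDelta`
import Literature.NumberTheory.Automorphic.AdeleAddCharLocalComponentsUnramified                  -- ★ `IsGlobalAddChar.exists_hasConductorExp_adicComponent`
import HarnessLib

/-!
# Crux `HLiu418`, socket #41 KIND 1 a♮ ∕ U1-glob LEVEL 2 — `K2LiuKindOneSingularLocalFace`: THE K1 TWISTED LOCAL FACE AT EVERY FINITE PLACE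
# `∫_{N_Δ(L⁺_v)} conj ψ_{S♭}(ι_v y) · G_s((w_Δ)_v y h) dν(y) = Gn(s, h)` WITH `s ↦ Gn(s,h)` `q_v`-RATIONAL AND REGULAR AT EVERY `s₀` OF `{0 < re}`

Cell `hodgecm-mathlib`, crux item hLiu418 = `stmt-HodgeConjecture-24832`, route `HCCMUnconditional`; squad K2 ∕ K2Liu, LEAD F0P6-plan (g14); desk K2E5-p16 (g8).
THEOREMS ONLY (no `def`, no instance, no notation, no named-fact hypothesis, no `sorry`); lane `--supports stmt-HodgeConjecture-24832 --as helper`.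

THE POINT.  ★ p863286 `K2LiuKindOneSingularGlobalAssembler` takes, per finite place `v` of the arbitrary set `T′`, the place letters `(Gn_v, hGn, hW)` BY VALUE: the local
factor `W_v(s,h) = ∫ ψ_v(y)·f_v(s)(Y_h y) dν_v` of ★ p862937's pure-tensor split of ★ G1's head must equal a function `Gn_v(s,h)` that is `q_v`-rational and regular at EVERY
`s₀` with `0 < re s₀`.  For the CORNER index `S♭ = single 1 1 σ` (★ p862643 (K1a-1)) the integrand of ★ G1 at `v ∈ T′` is
`conj ψ_{S♭}(ι_v y) · G_s((w_Δ)_v · y · h_v)` over `y ∈ unipDeltaLoc v` — and THIS FILE produces the letter, for every `K₀`-flat family `G` of smooth Siegel sections of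
`I_v(s, χ_v)` (`χ_v` unitary, `K₀` compact open with the Iwasawa property):
* §1 **`twistedRegularity_allPlaces`** (generic doubled datum `(F, E, c, δ, T₂, J₂D)`, any Δ-adapted frame `(D, D⁻¹, Q)`, coordinates `e` of ★ `exists_homeomorph_coordTwo`,
  any continuous additive `ψ` of `F_v` with a conductor exponent, `σ ≠ 0`): `∫ conj ψ(σ·b₁(u)) · f_s(w_Δ u h) dνN(u) = Gn s h` with `Gn` regular on `{0 < re}` — ★ p862868
  (one place of `E` above `v`) ∕ ★ p862834 (two places) over ★ `placesOver_cases'` give it at the frame's Weyl element `φ(w_Δ^J)`, and the Levi shift `w_Δ = m₀·φ(w_Δ^J)`,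
  `m₀ ∈ P_Δ(F_v)` (★ B4d-3 `weylDelta_eq_mul_frameConj_weylSiegel`, ★ `isSiegelDelta_weylDelta_mul_frameConj_weylSiegel`) multiplies by `χ_s(m₀)`, itself `q_v`-rational regular
  (★ B2 `isQRationalRegularAt_localSiegelCharacter`).
* §2 **`twistedLocalFace_unipDeltaLocal`** (the CM datum `(L⁺, L, gramR, hermD)`, `n = 2`): the character of ★ G1 — `conj ψ_{single 1 1 σ}(ι_v u)` — READ in the frame of
  ★ `exists_adaptedFrame_eq` by ★ `conj_unipDeltaChar_single_locToAdelic_frameConj_nSiegel`: `= ψ_{L⁺,v}(b₁(u)·τ)`, `τ = t₁·Tr_{L∕L⁺}(σ·δ_L)`, i.e. `= conj ψ_{L⁺,v}((−τ)·b₁(u))`; so §1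
  at `ψ := adeleAddCharAt L⁺ v` (continuous ★, conductor exponent ★ `IsGlobalAddChar.exists_hasConductorExp_adicComponent`), `σ := −τ_v` (`τ ≠ 0` BY VALUE: `hτ`).
* §3 **`exists_localFace_kindOneSingular`** — the same on the GLOBAL-COMAP subgroup `unipDeltaLoc v` against `(w_Δ)_v = evalPlace v (finPart w_Δ)` (★ B1
  `unipDeltaLoc_eq_unipDeltaLocal`, ★ `evalPlace_finPart_weylDelta`; the `subst` pattern of ★ `K2LiuUnipDeltaLocIntegralTransport`) — EXACTLY the place-letter binders
  `(Gn, hGn, hW)` of ★ p863286 at a finite place of `T′` (the `W` there being this integral), one `obtain` per place.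
HONEST LABEL.  Count-neutral helper; a local regularity letter of the K1-a♮ line, pays no socket by itself: `HC_CM` is proved only modulo the 7 printed citations (2 remaining named
inputs: hLiu418 = `stmt-HodgeConjecture-24832`, h413 = `stmt-HodgeConjecture-24833`) until rung 0 closes.

## References
* [KudlaRallis1994] S. Kudla, S. Rallis, *A regularized Siegel–Weil formula: the first term identity*, Ann. of Math. 140 (1994): §2 (singular coefficients via the rank-one chain).
* [KudlaSweet1997] S. Kudla, W. J. Sweet, *Degenerate principal series representations for U(n,n)*, Israel J. Math. 98 (1997): §1.
* [HarrisKudlaSweet1996] M. Harris, S. Kudla, W. J. Sweet, J. AMS 9 (1996): §1 (1.11)–(1.12), §6 (6.14)–(6.16).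
* [Casselman1980] W. Casselman, *The unramified principal series of p-adic groups I*, Compositio Math. 40 (1980): §3 Thm. 3.1.
* [Shimura1997] G. Shimura, *Euler Products and Eisenstein Series*, CBMS 93 (1997): §18.1 (18.4) (the local character `ψ(tr(S·X))`).
-/

set_option autoImplicit false
set_option linter.dupNamespace false -- the mandated namespace repeats `HodgeConjecture.HodgeConjecture`

noncomputable section

open scoped Classical NNReal ENNReal ComplexConjugate
open NumberField IsDedekindDomain Matrix MeasureTheory Topology
open Literature.NumberTheory.GaloisRepresentations.IsNonarchimedeanLocalField
open Literature.NumberTheory.Automorphic Literature.NumberTheory.Automorphic.UnitaryGroup Literature.NumberTheory.GaloisRepresentations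
open Literature.NumberTheory.GelbartRogawski1991 Literature.NumberTheory.GelbartRogawski1991.GRConstruction
open Literature.NumberTheory.GelbartRogawski1991.AdaptedBlocks
open Literature.NumberTheory.GelbartRogawski1991.UnitaryDualPair Literature.NumberTheory.GelbartRogawski1991.UnitaryDualPair.LocalSplitting
open Literature.NumberTheory.K2Lit Literature.NumberTheory.K2Lit.SiegelDoubled Literature.NumberTheory.K2Lit.LocalSiegelDoubled
open Summit.HodgeConjecture.HodgeConjecture.Cruxes.HLiu418.K2LiuQRationalDefs
open Summit.HodgeConjecture.HodgeConjecture.Cruxes.HLiu418.K2LiuLocalSiegelIwasawaFrame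
open Summit.HodgeConjecture.HodgeConjecture.Cruxes.HLiu418.K2LiuLocalSiegelIwasawa
open Summit.HodgeConjecture.HodgeConjecture.Cruxes.HLiu418.K2LiuDoubledUTwoTwoBorelFrame
open Summit.HodgeConjecture.HodgeConjecture.Cruxes.HLiu418.K2LiuDoubledUTwoTwoWeylCocycle
open Summit.HodgeConjecture.HodgeConjecture.Cruxes.HLiu418.K2LiuDoubledUTwoTwoLevi
open Summit.HodgeConjecture.HodgeConjecture.Cruxes.HLiu418.K2LiuDoubledUTwoTwoFrameTransport
open Summit.HodgeConjecture.HodgeConjecture.Cruxes.HLiu418.K2LiuDoubledUTwoTwoUnipotentHaar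
open Summit.HodgeConjecture.HodgeConjecture.Cruxes.HLiu418.K2LiuUnipDeltaRankOneCoordinates (conjLocal_coord)
open Summit.HodgeConjecture.HodgeConjecture.Cruxes.HLiu418.K2LiuSiegelIntertwiningCocycle
open Summit.HodgeConjecture.HodgeConjecture.Cruxes.HLiu418.K2LiuFlatSiegelFamilies
open Summit.HodgeConjecture.HodgeConjecture.Cruxes.HLiu418.K2LiuLocalRingPlaceDecomposition
open Summit.HodgeConjecture.HodgeConjecture.Cruxes.HLiu418.K2LiuRankOneSingularLocalRegularity (twistedRankOneRegularity_of_forall_eq)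
open Summit.HodgeConjecture.HodgeConjecture.Cruxes.HLiu418.K2LiuRankOneSingularLocalRegularitySplit (twistedRegularity_of_pair)
open Summit.HodgeConjecture.HodgeConjecture.Cruxes.HLiu418.K2LiuRankOneCornerCharacterReading
  (exists_adaptedFrame_eq conj_unipDeltaChar_single_locToAdelic_frameConj_nSiegel)
open Summit.HodgeConjecture.HodgeConjecture.Cruxes.HLiu418.K2LiuSiegelUnipotentLocalDefs (unipDeltaLoc)
open Summit.HodgeConjecture.HodgeConjecture.Cruxes.HLiu418.K2LiuSiegelUnipotentFourierDefs
open Summit.HodgeConjecture.HodgeConjecture.Cruxes.HLiu418.K2LiuSiegelUnipotentCharacters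
open Summit.HodgeConjecture.HodgeConjecture.Cruxes.HLiu418.K2LiuUnipDeltaLocBridge (unipDeltaLoc_eq_unipDeltaLocal)
open Summit.HodgeConjecture.HodgeConjecture.Cruxes.HLiu418.K2LiuLocalWhittakerFactorSkew (evalPlace_finPart_weylDelta)

namespace Summit.HodgeConjecture.HodgeConjecture.Cruxes.HLiu418.K2LiuKindOneSingularLocalFace

/-! ## §1 Generic doubled datum, any Δ-adapted frame: the twisted integral against `w_Δ` (every finite place, both place classes) -/

section EveryPlace

variable (F : Type) [Field F] [NumberField F] (E : Type) [Field E] [NumberField E] [Algebra F E]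
  [Algebra.IsQuadraticExtension F E] (c : E ≃ₐ[F] E)
  {δ : E} (hcδ : c δ = -δ) (hδ : δ ≠ 0) {d : F} (hd : δ * δ = algebraMap F E d) (v : HeightOneSpectrum (𝓞 F))
  {T₂ : Matrix (Fin 2) (Fin 2) F} (hT₂ : T₂.IsSymm) {J₂D : Matrix (Fin (2 + 2)) (Fin (2 + 2)) E} (hJ₂D : J₂D = (gramD F 2 T₂).map (algebraMap F E))
  (D Dinv : Matrix (Fin 2) (Fin 2) F) (hDD : D * Dinv = 1) (hDD' : Dinv * D = 1) (Q : GL (Fin (2 + 2)) F)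
  (hQm : (Q : Matrix (Fin (2 + 2)) (Fin (2 + 2)) F) = Matrix.reindex (e₂ 2) (e₂ 2) (Matrix.fromBlocks 1 D 1 (-D)))
  (hQ : (Q : Matrix (Fin (2 + 2)) (Fin (2 + 2)) F)ᵀ * gramD F 2 T₂ * (Q : Matrix (Fin (2 + 2)) (Fin (2 + 2)) F) = (StdForm.antidiagonal (2 + 2)).over F)

set_option maxHeartbeats 400000 in -- as ★ p862868 ∕ ★ p862834 (the same statement class; one `placesOver_cases'` dispatch + the Levi shift, no search tactics)
include hcδ hδ hd hT₂ hDD hQm hQ in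
/-- **THE TWISTED BIG-CELL INTEGRAL AGAINST `w_Δ` IS REGULAR ON ALL OF `0 < re s`, AT EVERY FINITE PLACE.**  For `χ_v` unitary, a compact open `K₀ ≤ H_v` with the Iwasawa
property `H_v = P_Δ(F_v)·K₀`, a `K₀`-flat family `f` of smooth Siegel sections of `I_v(s, χ_v)`, the unipotent coordinates `(e, he, hemul)` of ★ `exists_homeomorph_coordTwo` in a
Δ-adapted frame `(D, D⁻¹, Q)`, a continuous additive character `ψ` of `F_v` of conductor exponent `mψ`, and `σ ≠ 0`: there is `Gn : ℂ → H_v → ℂ`, every `s ↦ Gn s h`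
`q_v^{-s}`-rational and regular at EVERY `s₀` with `0 < re s₀`, with `∫ conj ψ(σ·(e.symm u).1) · f_s(w_Δ·u·h) dνN(u) = Gn s h` for `1 < re s` — ★ p862868 (one place of `E` above `v`)
∕ ★ p862834 (two places) at the frame's Weyl element `φ(w_Δ^J)`, carried to `w_Δ = m₀·φ(w_Δ^J)` by the Levi shift (`χ_s(m₀)` is `q_v`-rational regular, ★ B2).
[cite: KudlaRallis1994, §2] [cite: KudlaSweet1997, §1] [cite: HarrisKudlaSweet1996, §1 (1.12), §6 (6.14)–(6.16)] [cite: Casselman1980, §3 Thm. 3.1] -/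
theorem twistedRegularity_allPlaces
    [MeasurableSpace (unipDeltaLocal F E c v 2 (JD := J₂D))] [BorelSpace (unipDeltaLocal F E c v 2 (JD := J₂D))]
    (νN : Measure (unipDeltaLocal F E c v 2 (JD := J₂D))) [νN.IsHaarMeasure]
    (χv : ∀ w : PlacesOver E v, (w.1.adicCompletion E)ˣ →* ℂˣ) (hχ : ∀ (w' : PlacesOver E v) (x : (w'.1.adicCompletion E)ˣ), ‖((χv w' x : ℂˣ) : ℂ)‖ = 1)
    (K₀ : Subgroup (UnitaryGroup.localPi E c (2 + 2) J₂D v))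
    (hK₀ : IsCompact (K₀ : Set (UnitaryGroup.localPi E c (2 + 2) J₂D v)) ∧ IsOpen (K₀ : Set (UnitaryGroup.localPi E c (2 + 2) J₂D v)))
    (hIw : ∀ g : UnitaryGroup.localPi E c (2 + 2) J₂D v, ∃ p, IsSiegelDelta F E c hcδ hδ hd v 2 hT₂ hJ₂D p ∧ ∃ k ∈ K₀, g = p * k)
    (f : ℂ → UnitaryGroup.localPi E c (2 + 2) J₂D v → ℂ) (hSieg : ∀ s, IsLocalSiegelSection F E c hcδ hδ hd v 2 hT₂ hJ₂D χv s (f s)) (hsm : ∀ s, IsSmooth F E c v 2 (f s))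
    (hflat : ∀ s s' : ℂ, ∀ k ∈ K₀, f s k = f s' k)
    (e3 : (v.adicCompletion F × UnitaryGroup.LocalRing E v × v.adicCompletion F) ≃ₜ unipDeltaLocal F E c v 2 (JD := J₂D))
    (he3 : ∀ b₁ z b₂, ((e3 (b₁, z, b₂) : unipDeltaLocal F E c v 2 (JD := J₂D)) : UnitaryGroup.localPi E c (2 + 2) J₂D v) =
      FrameTransport.frameConj F E c v (2 + 2) hJ₂D (antidiagonal_over_eq_map F E 2) Q hQ
        (toLocalFour F E c v (nSiegel (UnitaryGroup.LocalRing E v) (UnitaryGroup.conjLocal E c v) (UnitaryGroup.conjLocal_conjLocal c v hcδ hδ)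
          (UnitaryGroup.toLocalRing E v b₁ * algebraMap E (UnitaryGroup.LocalRing E v) δ) z
          (UnitaryGroup.toLocalRing E v b₂ * algebraMap E (UnitaryGroup.LocalRing E v) δ)
          (conjLocal_coord F E c hcδ v b₁) (conjLocal_coord F E c hcδ v b₂))))
    (he3mul : ∀ p p', e3 (p + p') = e3 p * e3 p')
    (ψ : AddChar (v.adicCompletion F) Circle) (hψ : Continuous ψ) {mψ : ℤ} (hmψ : ψ.HasConductorExp mψ) (σ : v.adicCompletion F) (hσ : σ ≠ 0) :
    ∃ Gn : ℂ → UnitaryGroup.localPi E c (2 + 2) J₂D v → ℂ,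
      (∀ s₀ : ℂ, 0 < s₀.re → ∀ h, IsQRationalRegularAt (residueFieldCard (v.adicCompletion F)) s₀ (fun s => Gn s h)) ∧
      ∀ s : ℂ, 1 < s.re → ∀ h : UnitaryGroup.localPi E c (2 + 2) J₂D v,
        ∫ u, conj ((ψ (σ * (e3.symm u).1) : ℂ)) * f s (weylDelta F E c v 2 hJ₂D (T₀ := T₂) * (u : UnitaryGroup.localPi E c (2 + 2) J₂D v) * h) ∂νN = Gn s h := by
  -- the heads at the frame's Weyl element `φ(w_Δ^J)`, per place class
  obtain ⟨Gn', hreg', hval'⟩ : ∃ Gn' : ℂ → UnitaryGroup.localPi E c (2 + 2) J₂D v → ℂ,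
      (∀ s₀ : ℂ, 0 < s₀.re → ∀ h, IsQRationalRegularAt (residueFieldCard (v.adicCompletion F)) s₀ (fun s => Gn' s h)) ∧
      ∀ s : ℂ, 1 < s.re → ∀ h : UnitaryGroup.localPi E c (2 + 2) J₂D v,
        ∫ u, conj ((ψ (σ * (e3.symm u).1) : ℂ)) * f s (FrameTransport.frameConj F E c v (2 + 2) hJ₂D (antidiagonal_over_eq_map F E 2) Q hQ
          (toLocalFour F E c v (weylSiegel (UnitaryGroup.LocalRing E v) (UnitaryGroup.conjLocal E c v))) * (u : UnitaryGroup.localPi E c (2 + 2) J₂D v) * h) ∂νN =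
          Gn' s h := by
    rcases placesOver_cases' F E c v hcδ hδ with ⟨w, hw⟩ | ⟨w₁, w₂, hne, hw⟩
    · exact twistedRankOneRegularity_of_forall_eq F E c hcδ hδ hd v hT₂ hJ₂D D Dinv hDD Q hQm hQ νN χv hχ K₀ hK₀ hIw f hSieg hsm hflat e3 he3 he3mul
        ψ hψ hmψ hσ w hw
    · exact twistedRegularity_of_pair F E c hcδ hδ hd v hT₂ hJ₂D D Dinv hDD Q hQm hQ νN χv hχ K₀ hK₀ hIw f hSieg hsm hflat w₁ w₂ hne hw e3 he3 ψ hmψ σ hσ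
  -- the Levi shift `w_Δ = m₀ · φ(w_Δ^J)`, `m₀ ∈ P_Δ(F_v)`
  have hp₀ := isSiegelDelta_weylDelta_mul_frameConj_weylSiegel F E c hcδ hδ hd v hT₂ hJ₂D D Dinv hDD Q hQm hQ
  refine ⟨fun s h => localSiegelCharacter F E c v 2 χv s (weylDelta F E c v 2 hJ₂D (T₀ := T₂) *
      FrameTransport.frameConj F E c v (2 + 2) hJ₂D (antidiagonal_over_eq_map F E 2) Q hQ (toLocalFour F E c v (weylSiegel (UnitaryGroup.LocalRing E v) (UnitaryGroup.conjLocal E c v)))) *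
      Gn' s h, fun s₀ hs₀ h => (isQRationalRegularAt_localSiegelCharacter F E c hcδ hδ hd v 2 hT₂ hJ₂D χv hp₀ s₀).mul (hreg' s₀ hs₀ h), fun s hs h => ?_⟩
  show _ = localSiegelCharacter F E c v 2 χv s (weylDelta F E c v 2 hJ₂D (T₀ := T₂) *
      FrameTransport.frameConj F E c v (2 + 2) hJ₂D (antidiagonal_over_eq_map F E 2) Q hQ (toLocalFour F E c v (weylSiegel (UnitaryGroup.LocalRing E v) (UnitaryGroup.conjLocal E c v)))) *
      Gn' s h
  rw [← hval' s hs h, ← integral_const_mul]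
  refine integral_congr_ae (Filter.Eventually.of_forall fun u => ?_)
  have key : f s (weylDelta F E c v 2 hJ₂D (T₀ := T₂) * (u : UnitaryGroup.localPi E c (2 + 2) J₂D v) * h) =
      localSiegelCharacter F E c v 2 χv s (weylDelta F E c v 2 hJ₂D (T₀ := T₂) *
          FrameTransport.frameConj F E c v (2 + 2) hJ₂D (antidiagonal_over_eq_map F E 2) Q hQ (toLocalFour F E c v (weylSiegel (UnitaryGroup.LocalRing E v) (UnitaryGroup.conjLocal E c v)))) *
        f s (FrameTransport.frameConj F E c v (2 + 2) hJ₂D (antidiagonal_over_eq_map F E 2) Q hQ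
          (toLocalFour F E c v (weylSiegel (UnitaryGroup.LocalRing E v) (UnitaryGroup.conjLocal E c v))) * (u : UnitaryGroup.localPi E c (2 + 2) J₂D v) * h) := by
    conv_lhs => rw [weylDelta_eq_mul_frameConj_weylSiegel F E c v hJ₂D Q hQ]
    rw [mul_assoc, mul_assoc, (hSieg s) _ hp₀, ← mul_assoc]
  show conj ((ψ (σ * (e3.symm u).1) : ℂ)) * f s (weylDelta F E c v 2 hJ₂D (T₀ := T₂) * (u : UnitaryGroup.localPi E c (2 + 2) J₂D v) * h) = _
  rw [key]
  ring

end EveryPlace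

/-! ## §2 The CM datum: ★ G1's character `conj ψ_{single 1 1 σ}(ι_v u)` read in the adapted frame, on `unipDeltaLocal` -/

section CM

variable (L : Type) [Field L] [NumberField L] [IsCMField L] {N M : ℕ} (e : Fin N × Fin M ≃ Fin 2)
  (dV : Fin N → L) (hdV : ∀ i, IsCMField.complexConj L (dV i) = dV i) (hdV0 : ∀ i, dV i ≠ 0)
  (dW : Fin M → L) (hdW : ∀ i, IsCMField.complexConj L (dW i) = dW i) (hdW0 : ∀ i, dW i ≠ 0)
  (v : HeightOneSpectrum (𝓞 (Fp L)))

set_option maxHeartbeats 1600000 in -- MEASURED class: the K2Lit CM telescope (★ (E10) 800 000, ★ `exists_homeomorph_coordTwo` 1 600 000 for the nested `frameConj (toLocalFour (nSiegel …))` terms)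
include hdV0 hdW0 in
/-- **THE K1 TWISTED LOCAL FACE ON `unipDeltaLocal`, CM DATUM, `n = 2`.**  For the doubled CM datum `H_v = U(𝕎 ⊕ −𝕎)(L⁺_v)` (`T = gramR`, `J = hermD`, `δ = δ_L`), a unitary `χ_v`,
a compact open `K₀ ≤ H_v` with `H_v = P_Δ(L⁺_v)·K₀`, a `K₀`-flat family `G` of smooth Siegel sections of `I_v(s, χ_v)`, and `σ ∈ L` with `τ := t₁·Tr_{L∕L⁺}(σ·δ_L) ≠ 0`
(`t₁ = gramR 1 1`): there is `Gn : ℂ → H_v → ℂ`, each `s ↦ Gn s h` `q_v^{-s}`-rational and regular at EVERY `s₀` with `0 < re s₀`, such that for `1 < re s` and every `h`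
`∫ u, conj ψ_{single 1 1 σ}(ι_v u) · G_s(w_{Δ,v}·u·h) dνN(u) = Gn s h` — §1 in the frame of ★ `exists_adaptedFrame_eq` at `ψ := ψ_{L⁺,v}`, `σ := −τ_v`, the integrand converted by
★ `conj_unipDeltaChar_single_locToAdelic_frameConj_nSiegel` (`conj ψ_{S♭}(ι_v u) = ψ_{L⁺,v}(b₁(u)·τ) = conj ψ_{L⁺,v}((−τ)·b₁(u))`).
[cite: KudlaRallis1994, §2] [cite: Shimura1997, §18.1 (18.4)] [cite: HarrisKudlaSweet1996, §1 (1.11)–(1.12), §6 (6.14)–(6.16)] [cite: KudlaSweet1997, §1] -/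
theorem twistedLocalFace_unipDeltaLocal
    [MeasurableSpace (unipDeltaLocal (Fp L) L (IsCMField.complexConj L) v 2 (JD := hermD L e dV hdV dW hdW))]
    [BorelSpace (unipDeltaLocal (Fp L) L (IsCMField.complexConj L) v 2 (JD := hermD L e dV hdV dW hdW))]
    (νN : Measure (unipDeltaLocal (Fp L) L (IsCMField.complexConj L) v 2 (JD := hermD L e dV hdV dW hdW))) [νN.IsHaarMeasure]
    (χv : ∀ w : PlacesOver L v, (w.1.adicCompletion L)ˣ →* ℂˣ) (hχ : ∀ (w' : PlacesOver L v) (x : (w'.1.adicCompletion L)ˣ), ‖((χv w' x : ℂˣ) : ℂ)‖ = 1)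
    (K₀ : Subgroup (UnitaryGroup.localPi L (IsCMField.complexConj L) (2 + 2) (hermD L e dV hdV dW hdW) v))
    (hK₀ : IsCompact (K₀ : Set (UnitaryGroup.localPi L (IsCMField.complexConj L) (2 + 2) (hermD L e dV hdV dW hdW) v)) ∧
      IsOpen (K₀ : Set (UnitaryGroup.localPi L (IsCMField.complexConj L) (2 + 2) (hermD L e dV hdV dW hdW) v)))
    (hIw : haveI : Algebra.IsQuadraticExtension (Fp L) L := IsCMField.isQuadraticExtension L
      ∀ g : UnitaryGroup.localPi L (IsCMField.complexConj L) (2 + 2) (hermD L e dV hdV dW hdW) v,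
        ∃ p, IsSiegelDelta (Fp L) L (IsCMField.complexConj L) (complexConj_imagUnit L) (imagUnit_ne_zero L) (imagUnit_mul_self L)
          v 2 (gramR_isSymm L e dV hdV dW hdW) (hermD_eq_map_gramD L e dV hdV dW hdW) p ∧ ∃ k ∈ K₀, g = p * k)
    (G : ℂ → UnitaryGroup.localPi L (IsCMField.complexConj L) (2 + 2) (hermD L e dV hdV dW hdW) v → ℂ)
    (hSieg : haveI : Algebra.IsQuadraticExtension (Fp L) L := IsCMField.isQuadraticExtension L
      ∀ s, IsLocalSiegelSection (Fp L) L (IsCMField.complexConj L) (complexConj_imagUnit L) (imagUnit_ne_zero L) (imagUnit_mul_self L)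
        v 2 (gramR_isSymm L e dV hdV dW hdW) (hermD_eq_map_gramD L e dV hdV dW hdW) χv s (G s))
    (hsm : ∀ s, IsSmooth (Fp L) L (IsCMField.complexConj L) v 2 (G s))
    (hflat : ∀ s s' : ℂ, ∀ k ∈ K₀, G s k = G s' k)
    (σ : L) (hτ : gramR L e dV hdV dW hdW 1 1 * Algebra.trace (Fp L) L (σ * imagUnit L) ≠ 0) :
    ∃ Gn : ℂ → UnitaryGroup.localPi L (IsCMField.complexConj L) (2 + 2) (hermD L e dV hdV dW hdW) v → ℂ,
      (∀ s₀ : ℂ, 0 < s₀.re → ∀ h, IsQRationalRegularAt (residueFieldCard (v.adicCompletion (Fp L))) s₀ (fun s => Gn s h)) ∧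
      ∀ s : ℂ, 1 < s.re → ∀ h : UnitaryGroup.localPi L (IsCMField.complexConj L) (2 + 2) (hermD L e dV hdV dW hdW) v,
        ∫ u, conj ((unipDeltaChar L e dV hdV dW hdW (Matrix.single 1 1 σ)
              (locToAdelic L e dV hdV dW hdW v (u : UnitaryGroup.localPi L (IsCMField.complexConj L) (2 + 2) (hermD L e dV hdV dW hdW) v)) : ℂ)) *
            G s (UnitaryDualPair.LocalSplitting.weylDelta (Fp L) L (IsCMField.complexConj L) v 2 (hermD_eq_map_gramD L e dV hdV dW hdW) *
              (u : UnitaryGroup.localPi L (IsCMField.complexConj L) (2 + 2) (hermD L e dV hdV dW hdW) v) * h) ∂νN = Gn s h := by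
  haveI : Algebra.IsQuadraticExtension (Fp L) L := IsCMField.isQuadraticExtension L
  -- the Δ-adapted frame with its inverse block exposed, and the unipotent coordinates in it
  obtain ⟨D, Dinv, Q, hDD, hDD', hQm, hQ, -, hDinv⟩ :=
    exists_adaptedFrame_eq (Fp L) 2 (gramR_isSymm L e dV hdV dW hdW) (isUnit_det_gramR₀ L e dV hdV hdV0 dW hdW hdW0)
  obtain ⟨e3, he3, he3mul⟩ := exists_homeomorph_coordTwo (Fp L) L (IsCMField.complexConj L) (complexConj_imagUnit L) (imagUnit_ne_zero L) v
    (hermD_eq_map_gramD L e dV hdV dW hdW) D Dinv hDD hDD' Q hQm hQ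
  -- Tate's character at `v`: continuous, with a conductor exponent
  obtain ⟨mψ, hmψ⟩ := (isGlobalAddChar_adeleAddChar (Fp L)).exists_hasConductorExp_adicComponent v
  have hτv : -(algebraMap (Fp L) (v.adicCompletion (Fp L)) (gramR L e dV hdV dW hdW 1 1 * Algebra.trace (Fp L) L (σ * imagUnit L))) ≠ 0 :=
    neg_ne_zero.2 ((map_ne_zero _).2 hτ)
  obtain ⟨Gn, hreg, hval⟩ := twistedRegularity_allPlaces (Fp L) L (IsCMField.complexConj L) (complexConj_imagUnit L) (imagUnit_ne_zero L) (imagUnit_mul_self L) v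
    (gramR_isSymm L e dV hdV dW hdW) (hermD_eq_map_gramD L e dV hdV dW hdW) D Dinv hDD Q hQm hQ νN χv hχ K₀ hK₀ hIw G hSieg hsm hflat e3 he3 he3mul
    (adeleAddCharAt (Fp L) v) (continuous_adeleAddCharAt (K := Fp L) (v := v)) hmψ _ hτv
  refine ⟨Gn, hreg, fun s hs h => ?_⟩
  rw [← hval s hs h]
  refine integral_congr_ae (Filter.Eventually.of_forall fun u => ?_)
  -- the point `u` in coordinates, and the character read there
  have hu : (u : UnitaryGroup.localPi L (IsCMField.complexConj L) (2 + 2) (hermD L e dV hdV dW hdW) v) =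
      FrameTransport.frameConj (Fp L) L (IsCMField.complexConj L) v (2 + 2) (hermD_eq_map_gramD L e dV hdV dW hdW) (antidiagonal_over_eq_map (Fp L) L 2) Q hQ
        (toLocalFour (Fp L) L (IsCMField.complexConj L) v
          (nSiegel (UnitaryGroup.LocalRing L v) (UnitaryGroup.conjLocal L (IsCMField.complexConj L) v)
            (UnitaryGroup.conjLocal_conjLocal (IsCMField.complexConj L) v (complexConj_imagUnit L) (imagUnit_ne_zero L))
            (UnitaryGroup.toLocalRing L v (e3.symm u).1 * algebraMap L (UnitaryGroup.LocalRing L v) (imagUnit L)) (e3.symm u).2.1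
            (UnitaryGroup.toLocalRing L v (e3.symm u).2.2 * algebraMap L (UnitaryGroup.LocalRing L v) (imagUnit L))
            (conjLocal_coord (Fp L) L (IsCMField.complexConj L) (complexConj_imagUnit L) v (e3.symm u).1)
            (conjLocal_coord (Fp L) L (IsCMField.complexConj L) (complexConj_imagUnit L) v (e3.symm u).2.2))) := by
    have h := he3 (e3.symm u).1 (e3.symm u).2.1 (e3.symm u).2.2
    simp only [Prod.mk.eta, Homeomorph.apply_symm_apply] at h
    exact h
  have hchar : conj ((unipDeltaChar L e dV hdV dW hdW (Matrix.single 1 1 σ)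
        (locToAdelic L e dV hdV dW hdW v (u : UnitaryGroup.localPi L (IsCMField.complexConj L) (2 + 2) (hermD L e dV hdV dW hdW) v)) : ℂ)) =
      conj ((adeleAddCharAt (Fp L) v (-(algebraMap (Fp L) (v.adicCompletion (Fp L)) (gramR L e dV hdV dW hdW 1 1 * Algebra.trace (Fp L) L (σ * imagUnit L))) *
        (e3.symm u).1) : ℂ)) := by
    rw [hu, conj_unipDeltaChar_single_locToAdelic_frameConj_nSiegel L e dV hdV dW hdW v D Dinv hDD Q hQm hQ hDinv σ, neg_mul, AddChar.map_neg_eq_inv,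
      Circle.coe_inv_eq_conj, Complex.conj_conj, mul_comm]
  show conj ((unipDeltaChar L e dV hdV dW hdW (Matrix.single 1 1 σ)
        (locToAdelic L e dV hdV dW hdW v (u : UnitaryGroup.localPi L (IsCMField.complexConj L) (2 + 2) (hermD L e dV hdV dW hdW) v)) : ℂ)) * _ = _
  rw [hchar]

/-! ## §3 On the global-comap subgroup `unipDeltaLoc v` against `(w_Δ)_v = evalPlace v (finPart w_Δ)` — ★ G1's currency, the place letters of ★ p863286 -/

set_option maxHeartbeats 800000 in -- MEASURED class of ★ `K2LiuUnipDeltaLocIntegralTransport` §2 (200 000 ✗ `isDefEq` on the K2Lit CM telescope; 800 000 there)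
include hdV0 hdW0 in
/-- the `subst` step of ★ `K2LiuUnipDeltaLocIntegralTransport`: §2 on any subgroup EQUAL to `unipDeltaLocal` (★ B1 supplies `unipDeltaLoc v = unipDeltaLocal v`). [folklore] -/
theorem twistedLocalFace_of_eq_unipDeltaLocal
    {N' : Subgroup (UnitaryGroup.localPi L (IsCMField.complexConj L) (2 + 2) (hermD L e dV hdV dW hdW) v)}
    (hN' : N' = unipDeltaLocal (Fp L) L (IsCMField.complexConj L) v 2 (JD := hermD L e dV hdV dW hdW))
    [MeasurableSpace N'] [BorelSpace N'] (ν : Measure N') [ν.IsHaarMeasure]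
    (χv : ∀ w : PlacesOver L v, (w.1.adicCompletion L)ˣ →* ℂˣ) (hχ : ∀ (w' : PlacesOver L v) (x : (w'.1.adicCompletion L)ˣ), ‖((χv w' x : ℂˣ) : ℂ)‖ = 1)
    (K₀ : Subgroup (UnitaryGroup.localPi L (IsCMField.complexConj L) (2 + 2) (hermD L e dV hdV dW hdW) v))
    (hK₀ : IsCompact (K₀ : Set (UnitaryGroup.localPi L (IsCMField.complexConj L) (2 + 2) (hermD L e dV hdV dW hdW) v)) ∧
      IsOpen (K₀ : Set (UnitaryGroup.localPi L (IsCMField.complexConj L) (2 + 2) (hermD L e dV hdV dW hdW) v)))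
    (hIw : haveI : Algebra.IsQuadraticExtension (Fp L) L := IsCMField.isQuadraticExtension L
      ∀ g : UnitaryGroup.localPi L (IsCMField.complexConj L) (2 + 2) (hermD L e dV hdV dW hdW) v,
        ∃ p, IsSiegelDelta (Fp L) L (IsCMField.complexConj L) (complexConj_imagUnit L) (imagUnit_ne_zero L) (imagUnit_mul_self L)
          v 2 (gramR_isSymm L e dV hdV dW hdW) (hermD_eq_map_gramD L e dV hdV dW hdW) p ∧ ∃ k ∈ K₀, g = p * k)
    (G : ℂ → UnitaryGroup.localPi L (IsCMField.complexConj L) (2 + 2) (hermD L e dV hdV dW hdW) v → ℂ)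
    (hSieg : haveI : Algebra.IsQuadraticExtension (Fp L) L := IsCMField.isQuadraticExtension L
      ∀ s, IsLocalSiegelSection (Fp L) L (IsCMField.complexConj L) (complexConj_imagUnit L) (imagUnit_ne_zero L) (imagUnit_mul_self L)
        v 2 (gramR_isSymm L e dV hdV dW hdW) (hermD_eq_map_gramD L e dV hdV dW hdW) χv s (G s))
    (hsm : ∀ s, IsSmooth (Fp L) L (IsCMField.complexConj L) v 2 (G s))
    (hflat : ∀ s s' : ℂ, ∀ k ∈ K₀, G s k = G s' k)
    (σ : L) (hτ : gramR L e dV hdV dW hdW 1 1 * Algebra.trace (Fp L) L (σ * imagUnit L) ≠ 0) :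
    ∃ Gn : ℂ → UnitaryGroup.localPi L (IsCMField.complexConj L) (2 + 2) (hermD L e dV hdV dW hdW) v → ℂ,
      (∀ s₀ : ℂ, 0 < s₀.re → ∀ h, IsQRationalRegularAt (residueFieldCard (v.adicCompletion (Fp L))) s₀ (fun s => Gn s h)) ∧
      ∀ s : ℂ, 1 < s.re → ∀ h : UnitaryGroup.localPi L (IsCMField.complexConj L) (2 + 2) (hermD L e dV hdV dW hdW) v,
        ∫ u : N', conj ((unipDeltaChar L e dV hdV dW hdW (Matrix.single 1 1 σ)
              (locToAdelic L e dV hdV dW hdW v (u : UnitaryGroup.localPi L (IsCMField.complexConj L) (2 + 2) (hermD L e dV hdV dW hdW) v)) : ℂ)) *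
            G s (UnitaryDualPair.LocalSplitting.weylDelta (Fp L) L (IsCMField.complexConj L) v 2 (hermD_eq_map_gramD L e dV hdV dW hdW) *
              (u : UnitaryGroup.localPi L (IsCMField.complexConj L) (2 + 2) (hermD L e dV hdV dW hdW) v) * h) ∂ν = Gn s h := by
  subst hN'
  exact twistedLocalFace_unipDeltaLocal L e dV hdV hdV0 dW hdW hdW0 v ν χv hχ K₀ hK₀ hIw G hSieg hsm hflat σ hτ

set_option maxHeartbeats 800000 in -- MEASURED class of ★ `K2LiuUnipDeltaLocIntegralTransport` §2 (the K2Lit CM telescope under `rw [evalPlace_finPart_weylDelta]`)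
include hdV0 hdW0 in
/-- **THE K1 TWISTED LOCAL FACE** (the twin of ★ (E10) `exists_localFace`, in ★ G1's currency).  For the doubled CM datum `H_v = U(𝕎 ⊕ −𝕎)(L⁺_v)`, `rank 𝕎 = 2`, a unitary
`χ_v`, a compact open `K₀ ≤ H_v` with `H_v = P_Δ(L⁺_v)·K₀`, a `K₀`-flat family `G` of smooth Siegel sections of `I_v(s, χ_v)` (e.g. the (E6′) local flat family of a standard
section on an adapted compact, ★ (E10) §1), every Haar `ν` on the global-comap subgroup `unipDeltaLoc v`, and a corner entry `σ ∈ L` with `t₁·Tr_{L∕L⁺}(σ·δ_L) ≠ 0`: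
**there is `Gn : ℂ → H_v → ℂ`, every `s ↦ Gn s h` `q_v^{-s}`-rational and regular at EVERY `s₀` with `0 < re s₀`, such that for `1 < re s` and every `h ∈ H_v`
`∫ y, conj ψ_{single 1 1 σ}(ι_v y) · G_s((w_Δ)_v · y · h) dν(y) = Gn s h`** — the place-letter binders `(Gn, hGn, hW)` of ★ p863286 `K2LiuKindOneSingularGlobalAssembler` at a finite
place of `T′`, for the corner-twisted local factor of ★ G1 (`(w_Δ)_v = evalPlace v (finPart w_Δ)` ★, `unipDeltaLoc v = unipDeltaLocal v` ★ B1).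
[cite: KudlaRallis1994, §2] [cite: KudlaSweet1997, §1] [cite: HarrisKudlaSweet1996, §6 (6.14)–(6.16)] [cite: Casselman1980, §3 Thm. 3.1] [cite: Shimura1997, §18.1 (18.4)] -/
theorem exists_localFace_kindOneSingular
    [MeasurableSpace ↥(unipDeltaLoc L e dV hdV dW hdW v)] [BorelSpace ↥(unipDeltaLoc L e dV hdV dW hdW v)] (ν : Measure ↥(unipDeltaLoc L e dV hdV dW hdW v)) [ν.IsHaarMeasure]
    (χv : ∀ w : PlacesOver L v, (w.1.adicCompletion L)ˣ →* ℂˣ) (hχ : ∀ (w' : PlacesOver L v) (x : (w'.1.adicCompletion L)ˣ), ‖((χv w' x : ℂˣ) : ℂ)‖ = 1)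
    (K₀ : Subgroup (UnitaryGroup.localPi L (IsCMField.complexConj L) (2 + 2) (hermD L e dV hdV dW hdW) v))
    (hK₀ : IsCompact (K₀ : Set (UnitaryGroup.localPi L (IsCMField.complexConj L) (2 + 2) (hermD L e dV hdV dW hdW) v)) ∧
      IsOpen (K₀ : Set (UnitaryGroup.localPi L (IsCMField.complexConj L) (2 + 2) (hermD L e dV hdV dW hdW) v)))
    (hIw : haveI : Algebra.IsQuadraticExtension (Fp L) L := IsCMField.isQuadraticExtension L
      ∀ g : UnitaryGroup.localPi L (IsCMField.complexConj L) (2 + 2) (hermD L e dV hdV dW hdW) v,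
        ∃ p, IsSiegelDelta (Fp L) L (IsCMField.complexConj L) (complexConj_imagUnit L) (imagUnit_ne_zero L) (imagUnit_mul_self L)
          v 2 (gramR_isSymm L e dV hdV dW hdW) (hermD_eq_map_gramD L e dV hdV dW hdW) p ∧ ∃ k ∈ K₀, g = p * k)
    (G : ℂ → UnitaryGroup.localPi L (IsCMField.complexConj L) (2 + 2) (hermD L e dV hdV dW hdW) v → ℂ)
    (hSieg : haveI : Algebra.IsQuadraticExtension (Fp L) L := IsCMField.isQuadraticExtension L
      ∀ s, IsLocalSiegelSection (Fp L) L (IsCMField.complexConj L) (complexConj_imagUnit L) (imagUnit_ne_zero L) (imagUnit_mul_self L)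
        v 2 (gramR_isSymm L e dV hdV dW hdW) (hermD_eq_map_gramD L e dV hdV dW hdW) χv s (G s))
    (hsm : ∀ s, IsSmooth (Fp L) L (IsCMField.complexConj L) v 2 (G s))
    (hflat : ∀ s s' : ℂ, ∀ k ∈ K₀, G s k = G s' k)
    (σ : L) (hτ : gramR L e dV hdV dW hdW 1 1 * Algebra.trace (Fp L) L (σ * imagUnit L) ≠ 0) :
    ∃ Gn : ℂ → UnitaryGroup.localPi L (IsCMField.complexConj L) (2 + 2) (hermD L e dV hdV dW hdW) v → ℂ,
      (∀ s₀ : ℂ, 0 < s₀.re → ∀ h, IsQRationalRegularAt (residueFieldCard (v.adicCompletion (Fp L))) s₀ (fun s => Gn s h)) ∧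
      ∀ s : ℂ, 1 < s.re → ∀ h : UnitaryGroup.localPi L (IsCMField.complexConj L) (2 + 2) (hermD L e dV hdV dW hdW) v,
        ∫ y : ↥(unipDeltaLoc L e dV hdV dW hdW v), conj ((unipDeltaChar L e dV hdV dW hdW (Matrix.single 1 1 σ)
              (locToAdelic L e dV hdV dW hdW v (y : UnitaryGroup.localPi L (IsCMField.complexConj L) (2 + 2) (hermD L e dV hdV dW hdW) v)) : ℂ)) *
            G s (UnitaryGroup.evalPlace (Fp L) L (IsCMField.complexConj L) (2 + 2) (hermD L e dV hdV dW hdW) v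
                  (UnitaryGroup.finPart (Fp L) L (IsCMField.complexConj L) (2 + 2) (hermD L e dV hdV dW hdW) (SiegelDoubled.weylDelta L e dV hdV dW hdW)) *
              (y : UnitaryGroup.localPi L (IsCMField.complexConj L) (2 + 2) (hermD L e dV hdV dW hdW) v) * h) ∂ν = Gn s h := by
  rw [evalPlace_finPart_weylDelta]
  exact twistedLocalFace_of_eq_unipDeltaLocal L e dV hdV hdV0 dW hdW hdW0 v (unipDeltaLoc_eq_unipDeltaLocal L e dV hdV dW hdW v) ν χv hχ K₀ hK₀ hIw G hSieg hsm hflat σ hτ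

end CM

end Summit.HodgeConjecture.HodgeConjecture.Cruxes.HLiu418.K2LiuKindOneSingularLocalFace

end
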